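import Literature.Computability.MetaComplexity.CMMSA
import Literature.Computability.Complexity.Approximation
import Literature.Computability.Complexity.CNFInvariance
import HarnessLib

/-!
# Gap-E3SAT as constant-gap CMMSA of degree `3`

Topic `Computability/Complexity`. The base of the self-improvement ladder of `CMMSASquaring.lean`:
an embedding of `3`-CNFs into CMMSA instances (Hirahara 2022, Def. 5.1) of degree `3` and soundness
`1` — the "minimum hitting set" instances of Alekhnovich–Buss–Moran–Pitassi 2001, §2 ("MMSA is at
least as hard as Minimum Hitting Set … MMSA where the propositional formula is in conjunctive normal
form"), with the consistency of the two polarities of a variable priced by weights exactly as in the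
Dinur–Safra reduction used by Hirahara (proof of Thm. 5.2, p. 17: the literal `L_{x,a}` weighs the
number `|Ψ(x)|` of constraints on `x`). For a CNF `φ` with `m` clauses and `N` literal occurrences
(variables relabelled by first occurrence, `firstIdx`, so that the instance is dense whatever the
variable names): variables `x_{u,0}, x_{u,1}` (`u < N`; "the `u`-th variable is false / true"),
one formula `x_{u₁,b₁} ∨ x_{u₂,b₂} ∨ x_{u₃,b₃}` per clause, one formula `x_{u,0} ∨ x_{u,1}` per `u`,
weights `w(x_{u,b}) = occ(u)` (occurrences of the variable), threshold `N`.

* `CNFToCMMSA.toCMMSA φ` — the instance; `wellFormed_toCMMSA`, `degree_toCMMSA_le` (`≤ 3` for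
  `3`-CNFs);
* `CNFToCMMSA.toCMMSA_mem_yesSet` — a satisfiable `3`-CNF gives a yes-instance (the indicator of a
  satisfying assignment weighs exactly `N`);
* `CNFToCMMSA.toCMMSA_mem_noSet` — a `3`-CNF of value `≤ 7/8 + ε` (`ε < 1/8`) gives a no-instance at
  the gap `baseGap ε = 1 + (1/8 - ε)/4`: an all-satisfying assignment of weight `≤ g · N` sets both
  polarities on a set `D` of variables with `occ(D) ≤ (g - 1) N ≤ 3 (g - 1) m`, and reading off one
  polarity elsewhere satisfies every clause not touching `D`, i.e. all but `≤ occ(D) < (1/8 - ε) m`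
  clauses — more than the value allows.

The polynomial-time implementation and the NP-hardness transfer from `gapE3SAT ε` are in
`CNFToCMMSAMachine.lean`; the self-improvement of the target problem is `CMMSASquaring.lean`.

## References

* M. Alekhnovich, S. Buss, S. Moran, T. Pitassi, *Minimum propositional proof length is NP-hard to
  linearly approximate*, J. Symbolic Logic 66 (2001) 171–191, §2 (MMSA and Minimum Hitting Set;
  proof of Thm. 3: "a polynomial time reduction from Satisfiability to approximation of MMSA within
  factor 2") [AlekhnovichEtAl2001].
* S. Hirahara, *NP-hardness of learning programs and partial MCSP*, ECCC TR22-119, Def. 5.1 and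
  proof of Thm. 5.2 (p. 17, the weights `w(L_{x,a}) = |Ψ(x)|`) [Hirahara2022PartialMCSP].
* J. Håstad, *Some optimal inapproximability results*, J. ACM 48 (2001), Thm. 6.5 (gap-E3SAT)
  [Hastad2001]; S. Arora, B. Barak, *Computational Complexity: A Modern Approach*, CUP 2009,
  §11.2–11.3 (`val(φ)`, gap problems) [AroraBarak2009].
-/

namespace Literature.Computability.Complexity

open MetaComplexity

namespace CNFToCMMSA

/-! ### First-occurrence indices -/

/-- The index of the first occurrence of `v` in `l` (`|l|` if absent). [folklore] -/
def firstIdx (v : ℕ) : List ℕ → ℕ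
  | [] => 0
  | a :: l => if a = v then 0 else firstIdx v l + 1

/-- `firstIdx v [] = 0`. [folklore] -/
@[simp] theorem firstIdx_nil (v : ℕ) : firstIdx v [] = 0 := rfl

/-- `firstIdx` on a cons. [folklore] -/
theorem firstIdx_cons (v a : ℕ) (l : List ℕ) : firstIdx v (a :: l) = if a = v then 0 else firstIdx v l + 1 := rfl

/-- The first-occurrence index of a member is in range. [folklore] -/
theorem firstIdx_lt_length {v : ℕ} : ∀ {l : List ℕ}, v ∈ l → firstIdx v l < l.length
  | [], h => by simp at h
  | a :: l, h => by
    rw [firstIdx_cons]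
    split_ifs with hav
    · simp
    · have hv : v ∈ l := by
        rcases List.mem_cons.1 h with rfl | h'
        · exact absurd rfl hav
        · exact h'
      simpa using firstIdx_lt_length hv

/-- `firstIdx v l ≤ |l|`. [folklore] -/
theorem firstIdx_le_length (v : ℕ) : ∀ l : List ℕ, firstIdx v l ≤ l.length
  | [] => le_rfl
  | a :: l => by
    rw [firstIdx_cons]
    split_ifs
    · simp
    · simpa using firstIdx_le_length v l

/-- The item at the first-occurrence index of a member is the member: relabelling by `firstIdx` is
injective on the members. [folklore] -/
theorem getD_firstIdx {v : ℕ} (d : ℕ) : ∀ {l : List ℕ}, v ∈ l → l.getD (firstIdx v l) d = v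
  | [], h => by simp at h
  | a :: l, h => by
    rw [firstIdx_cons]
    split_ifs with hav
    · simpa using hav
    · have hv : v ∈ l := by
        rcases List.mem_cons.1 h with rfl | h'
        · exact absurd rfl hav
        · exact h'
      simpa using getD_firstIdx d hv

/-- The step of the left-to-right scan computing `firstIdx`: state `(k, found)`. [folklore] -/
def idxStep (v a : ℕ) (st : ℕ × Bool) : ℕ × Bool :=
  if st.2 then st else if a = v then (st.1, true) else (st.1 + 1, false)

/-- Semantics of the scan: from `(k, false)` it ends in `(k + firstIdx v l, [v ∈ l])`, and a found
state is stable. [folklore] -/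
theorem foldl_idxStep (v : ℕ) : ∀ (l : List ℕ) (k : ℕ),
    l.foldl (fun st a => idxStep v a st) (k, false) = (k + firstIdx v l, decide (v ∈ l)) ∧
    l.foldl (fun st a => idxStep v a st) (k, true) = (k, true)
  | [], k => by simp
  | a :: l, k => by
    constructor
    · rw [List.foldl_cons, firstIdx_cons]
      by_cases hav : a = v
      · subst hav
        have h1 : idxStep a a (k, false) = (k, true) := by simp [idxStep]
        rw [h1, (foldl_idxStep a l k).2]
        simp
      · have h1 : idxStep v a (k, false) = (k + 1, false) := by simp [idxStep, hav]
        rw [h1, (foldl_idxStep v l (k + 1)).1, if_neg hav]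
        have hne : ¬ v = a := fun h => hav h.symm
        refine Prod.ext ?_ ?_
        · show k + 1 + firstIdx v l = k + (firstIdx v l + 1)
          omega
        · show decide (v ∈ l) = decide (v ∈ a :: l)
          simp [hne]
    · rw [List.foldl_cons]
      have h1 : idxStep v a (k, true) = (k, true) := by simp [idxStep]
      rw [h1, (foldl_idxStep v l k).2]

/-! ### The construction -/

/-- The list of variable occurrences of a CNF, in order (length `N` = the number of literal
occurrences). [folklore] -/
def varList (φ : CNF ℕ) : List ℕ :=
  φ.flatten.map Prod.fst

/-- The CMMSA variable `x_{u,b} = 2u + b` of a literal `(x, b)`, `u` the first occurrence of `x`.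
[cite: Hirahara2022PartialMCSP, proof of Thm. 5.2 (the literals L_{x,a})] -/
def litVar (V : List ℕ) (l : Literal ℕ) : ℕ :=
  2 * firstIdx l.1 V + l.2.toNat

/-- The formula of a clause: the disjunction of the variables of its literals (singleton terms).
[cite: AlekhnovichEtAl2001, §2 ("MMSA is at least as hard as Minimum Hitting Set")] -/
def clauseFormula (V : List ℕ) (C : Clause ℕ) : MonotoneDNF :=
  C.map fun l => [litVar V l]

/-- The totality formula `x_{u,0} ∨ x_{u,1}` of the variable `u`. [cite: Hirahara2022PartialMCSP, proof of Thm. 5.2 (every variable receives a value)] -/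
def totFormula (u : ℕ) : MonotoneDNF :=
  [[2 * u], [2 * u + 1]]

/-- The number of occurrences of the `u`-th variable. [cite: Hirahara2022PartialMCSP, proof of Thm. 5.2 (w(L_{x,a}) = |Ψ(x)|)] -/
def occW (V : List ℕ) (u : ℕ) : ℕ :=
  V.countP fun v => decide (firstIdx v V = u)

/-- The weight list: `w(2u) = w(2u + 1) = occ(u)` for `u < N`. [cite: Hirahara2022PartialMCSP, proof of Thm. 5.2 (p. 17)] -/
def weights (V : List ℕ) : List ℕ :=
  ((List.range V.length).map fun u => [occW V u, occW V u]).flatten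

/-- **The CMMSA instance of a CNF**: `2N` variables, the clause and totality formulas, the
occurrence weights, threshold `N`. [cite: AlekhnovichEtAl2001, §2; Hirahara2022PartialMCSP, proof of Thm. 5.2] -/
def toCMMSA (φ : CNF ℕ) : CMMSAInstance :=
  ⟨2 * (varList φ).length,
    φ.map (clauseFormula (varList φ)) ++ (List.range (varList φ).length).map totFormula,
    weights (varList φ), (varList φ).length⟩

/-- The base gap `1 + (1/8 - ε)/4`. [folklore] -/
noncomputable def baseGap (ε : ℚ) : ℝ :=
  1 + (1 / 8 - (ε : ℝ)) / 4

/-- `baseGap ε ≥ 1` for `ε ≤ 1/8`. [folklore] -/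
theorem one_le_baseGap {ε : ℚ} (hε : ε ≤ 1 / 8) : 1 ≤ baseGap ε := by
  unfold baseGap
  have : (ε : ℝ) ≤ 1 / 8 := by
    have h := (Rat.cast_le (K := ℝ)).2 hε
    simpa using h
  linarith

/-- `baseGap ε > 1` for `ε < 1/8`. [folklore] -/
theorem one_lt_baseGap {ε : ℚ} (hε : ε < 1 / 8) : 1 < baseGap ε := by
  unfold baseGap
  have : (ε : ℝ) < 1 / 8 := by
    have h := (Rat.cast_lt (K := ℝ)).2 hε
    simpa using h
  linarith

/-! ### Elementary facts -/

/-- `|varList φ| = size φ` (the number of literal occurrences). [folklore] -/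
theorem length_varList (φ : CNF ℕ) : (varList φ).length = φ.size := by
  unfold varList CNF.size
  rw [List.length_map, List.length_flatten]

/-- A `3`-CNF has at most `3m` literal occurrences. [folklore] -/
theorem size_le_of_isWidthLE {φ : CNF ℕ} (h : φ.IsWidthLE 3) : φ.size ≤ 3 * φ.numClauses := by
  unfold CNF.size CNF.numClauses
  calc (φ.map List.length).sum ≤ (φ.map List.length).length • 3 :=
        List.sum_le_card_nsmul _ _ fun x hx => by
          obtain ⟨C, hC, rfl⟩ := List.mem_map.1 hx
          exact h C hC
    _ = 3 * φ.length := by rw [List.length_map, smul_eq_mul, mul_comm]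

/-- The variable of a literal of a clause of `φ` occurs in `varList φ`. [folklore] -/
theorem mem_varList {φ : CNF ℕ} {C : Clause ℕ} (hC : C ∈ φ) {l : Literal ℕ} (hl : l ∈ C) :
    l.1 ∈ varList φ :=
  List.mem_map.2 ⟨l, List.mem_flatten.2 ⟨C, hC, hl⟩, rfl⟩

/-- The CMMSA variable of a literal over `V` is `< 2|V|`. [folklore] -/
theorem litVar_lt {V : List ℕ} {l : Literal ℕ} (h : l.1 ∈ V) : litVar V l < 2 * V.length := by
  unfold litVar
  have := firstIdx_lt_length h
  cases l.2 <;> simp <;> omega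

/-- `|weights V| = 2|V|`. [folklore] -/
theorem length_weights (V : List ℕ) : (weights V).length = 2 * V.length := by
  unfold weights
  rw [List.length_flatten, List.map_map]
  have : (List.range V.length).map (List.length ∘ fun u => [occW V u, occW V u]) =
      List.replicate V.length 2 := by
    rw [List.eq_replicate_iff]
    exact ⟨by simp, fun b hb => by
      obtain ⟨u, -, rfl⟩ := List.mem_map.1 hb
      rfl⟩
  rw [this, List.sum_replicate, smul_eq_mul, mul_comm]

/-- Indexing a flattened list of rows of a common length. [folklore] -/
theorem getD_flatten_rows {n d : ℕ} :
    ∀ (L : List (List ℕ)), (∀ l ∈ L, l.length = n) → ∀ (i i' : ℕ), i' < n →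
      L.flatten.getD (i * n + i') d = (L.getD i []).getD i' d
  | [], _, i, i', _ => by simp
  | l :: L, hL, 0, i', hi' => by
    have hl : l.length = n := hL l List.mem_cons_self
    rw [List.flatten_cons, zero_mul, zero_add, List.getD_append _ _ _ _ (by omega)]
    simp
  | l :: L, hL, i + 1, i', hi' => by
    have hl : l.length = n := hL l List.mem_cons_self
    rw [List.flatten_cons, List.getD_append_right _ _ _ _ (by rw [hl]; nlinarith),
      show (i + 1) * n + i' - l.length = i * n + i' by rw [hl]; ring_nf; omega]
    rw [getD_flatten_rows L (fun l' hl' => hL l' (List.mem_cons_of_mem _ hl')) i i' hi']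
    simp

/-- The soundness-`1` no-condition in terms of falsified formulas. [folklore] -/
theorem real_satCount_lt_one_iff (I : CMMSAInstance) (a : ℕ → Bool) :
    (I.satCount a : ℝ) < 1 * I.numFormulas ↔ ∃ φ ∈ I.formulas, φ.eval a = false := by
  have hle := I.satCount_le_numFormulas a
  rw [one_mul, Nat.cast_lt, lt_iff_le_and_ne, and_iff_right hle, Ne, I.satCount_eq_numFormulas_iff]
  push Not
  simp only [Bool.not_eq_true]

/-- The weights of an instance carrying `weights Pos`: `w(2u + b) = occ(u)` for `u < |Pos|`, `b < 2`.
[cite: Hirahara2022PartialMCSP, proof of Thm. 5.2 (p. 17)] -/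
theorem w_of_weights {I : CMMSAInstance} {Pos : List ℕ} (hw : I.weight = weights Pos) {u b : ℕ}
    (hu : u < Pos.length) (hb : b < 2) : I.w (2 * u + b) = occW Pos u := by
  unfold CMMSAInstance.w
  rw [hw]
  unfold weights
  rw [mul_comm 2 u, getD_flatten_rows _ (fun l hl => by
      obtain ⟨u', -, rfl⟩ := List.mem_map.1 hl
      rfl) u b hb]
  have hrow : ((List.range Pos.length).map fun u => [occW Pos u, occW Pos u]).getD u [] =
      [occW Pos u, occW Pos u] := by
    rw [List.getD_eq_getElem _ _ (by simpa using hu), List.getElem_map, List.getElem_range]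
  rw [hrow]
  have : b = 0 ∨ b = 1 := by omega
  rcases this with rfl | rfl <;> rfl

/-- The weights: `w(2u + b) = occ(u)` for `u < N`, `b < 2`. [cite: Hirahara2022PartialMCSP, proof of Thm. 5.2 (p. 17)] -/
theorem w_toCMMSA (φ : CNF ℕ) {u b : ℕ} (hu : u < (varList φ).length) (hb : b < 2) :
    (toCMMSA φ).w (2 * u + b) = occW (varList φ) u :=
  w_of_weights rfl hu hb

/-- A sum over `range (2N)` in even/odd pairs. [folklore] -/
theorem sum_range_two_mul (f : ℕ → ℕ) (N : ℕ) :
    ∑ t ∈ Finset.range (2 * N), f t = ∑ u ∈ Finset.range N, (f (2 * u) + f (2 * u + 1)) := by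
  induction N with
  | zero => simp
  | succ N ih =>
    rw [show 2 * (N + 1) = 2 * N + 1 + 1 by ring, Finset.sum_range_succ, Finset.sum_range_succ, ih,
      Finset.sum_range_succ]
    ring

/-- **The weight of an assignment** of an instance with `2|Pos|` variables carrying `weights Pos`:
`w(a) = Σ_{u < |Pos|} occ(u) · (a(2u) + a(2u+1))`. [cite: Hirahara2022PartialMCSP, proof of Thm. 5.2 (p. 17, Eq. (4))] -/
theorem weightOf_of_weights {I : CMMSAInstance} {Pos : List ℕ} (hn : I.numVars = 2 * Pos.length)
    (hw : I.weight = weights Pos) (a : ℕ → Bool) :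
    I.weightOf a = ∑ u ∈ Finset.range Pos.length,
      occW Pos u * ((if a (2 * u) then 1 else 0) + (if a (2 * u + 1) then 1 else 0)) := by
  unfold CMMSAInstance.weightOf
  rw [hn, sum_range_two_mul]
  refine Finset.sum_congr rfl fun u hu => ?_
  have hu' := Finset.mem_range.1 hu
  have h0 : I.w (2 * u) = occW Pos u := by
    simpa using w_of_weights hw hu' (b := 0) (by norm_num)
  have h1 : I.w (2 * u + 1) = occW Pos u := w_of_weights hw hu' (by norm_num)
  rw [h0, h1, mul_add, mul_ite, mul_ite, mul_one, mul_zero]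

/-- **The weight of an assignment**: `w(a) = Σ_{u < N} occ(u) · (a(2u) + a(2u+1))`.
[cite: Hirahara2022PartialMCSP, proof of Thm. 5.2 (p. 17, Eq. (4))] -/
theorem weightOf_toCMMSA (φ : CNF ℕ) (a : ℕ → Bool) :
    (toCMMSA φ).weightOf a = ∑ u ∈ Finset.range (varList φ).length,
      occW (varList φ) u * ((if a (2 * u) then 1 else 0) + (if a (2 * u + 1) then 1 else 0)) :=
  weightOf_of_weights rfl rfl a

/-- Counting by value of a function into `range N`. [folklore] -/
theorem sum_range_countP_eq (f : ℕ → ℕ) (N : ℕ) : ∀ l : List ℕ,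
    ∑ u ∈ Finset.range N, l.countP (fun v => decide (f v = u)) = l.countP fun v => decide (f v < N)
  | [] => by simp
  | a :: l => by
    simp only [List.countP_cons, Finset.sum_add_distrib, sum_range_countP_eq f N l, decide_eq_true_eq]
    congr 1
    rw [Finset.sum_ite_eq (Finset.range N) (f a) (fun _ => 1)]
    simp [Finset.mem_range]

/-- **The occurrence weights sum to `N`.** [cite: Hirahara2022PartialMCSP, proof of Thm. 5.2 (Σₓ |Ψ(x)| = mD)] -/
theorem sum_occW (V : List ℕ) : ∑ u ∈ Finset.range V.length, occW V u = V.length := by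
  unfold occW
  rw [sum_range_countP_eq, List.countP_eq_length.2]
  intro v hv
  simpa using firstIdx_lt_length hv

/-- Membership in the formulas of `toCMMSA φ`. [folklore] -/
theorem mem_formulas_iff (φ : CNF ℕ) (ψ : MonotoneDNF) :
    ψ ∈ (toCMMSA φ).formulas ↔
      (∃ C ∈ φ, clauseFormula (varList φ) C = ψ) ∨ ∃ u < (varList φ).length, totFormula u = ψ := by
  show ψ ∈ φ.map (clauseFormula (varList φ)) ++ (List.range (varList φ).length).map totFormula ↔ _
  simp [List.mem_append, List.mem_map]

/-- The literal count of a clause formula is the clause length. [folklore] -/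
theorem numLiterals_clauseFormula (V : List ℕ) (C : Clause ℕ) : (clauseFormula V C).numLiterals = C.length := by
  unfold clauseFormula MonotoneDNF.numLiterals
  rw [List.map_map]
  have : (List.length ∘ fun l => [litVar V l]) = fun _ => 1 := by funext l; rfl
  rw [this, List.map_const', List.sum_replicate, smul_eq_mul, mul_one]

/-- **`toCMMSA φ` is well formed.** [folklore] -/
theorem wellFormed_toCMMSA (φ : CNF ℕ) : (toCMMSA φ).WellFormed := by
  refine ⟨length_weights _, fun ψ hψ t ht i hi => ?_⟩
  show i < 2 * (varList φ).length
  rcases (mem_formulas_iff φ ψ).1 hψ with ⟨C, hC, rfl⟩ | ⟨u, hu, rfl⟩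
  · unfold clauseFormula at ht
    obtain ⟨l, hl, rfl⟩ := List.mem_map.1 ht
    rw [List.mem_singleton] at hi
    subst hi
    exact litVar_lt (mem_varList hC hl)
  · unfold totFormula at ht
    simp only [List.mem_cons, List.not_mem_nil, or_false] at ht
    rcases ht with rfl | rfl
    · rw [List.mem_singleton] at hi; omega
    · rw [List.mem_singleton] at hi; omega

/-- **`toCMMSA φ` has degree `≤ 3` for `3`-CNFs.** [cite: Hirahara2022PartialMCSP, Def. 5.1 (degree)] -/
theorem degree_toCMMSA_le {φ : CNF ℕ} (h : φ.IsWidthLE 3) : (toCMMSA φ).degree ≤ 3 := by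
  rw [CMMSAInstance.degree_le_iff]
  intro ψ hψ
  rcases (mem_formulas_iff φ ψ).1 hψ with ⟨C, hC, rfl⟩ | ⟨u, -, rfl⟩
  · rw [numLiterals_clauseFormula]; exact h C hC
  · show 1 + (1 + 0) ≤ 3; norm_num

/-! ### Completeness -/

/-- The assignment of the CMMSA variables induced by `σ`: `x_{u,b} ↦ [σ(x_u) = b]`. [cite: Hirahara2022PartialMCSP, proof of Thm. 5.2 (completeness)] -/
def yesAssign (V : List ℕ) (σ : ℕ → Bool) (t : ℕ) : Bool :=
  σ (V.getD (t / 2) 0) == decide (t % 2 = 1)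

/-- `yesAssign` on `x_{u,0}`. [folklore] -/
theorem yesAssign_even (V : List ℕ) (σ : ℕ → Bool) (u : ℕ) :
    yesAssign V σ (2 * u) = (σ (V.getD u 0) == false) := by
  unfold yesAssign
  rw [Nat.mul_div_cancel_left u two_pos, Nat.mul_mod_right]
  rfl

/-- `yesAssign` on `x_{u,1}`. [folklore] -/
theorem yesAssign_odd (V : List ℕ) (σ : ℕ → Bool) (u : ℕ) :
    yesAssign V σ (2 * u + 1) = (σ (V.getD u 0) == true) := by
  unfold yesAssign
  have h1 : (2 * u + 1) / 2 = u := by omega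
  have h2 : (2 * u + 1) % 2 = 1 := by omega
  rw [h1, h2]
  rfl

/-- `yesAssign` on the variable of a literal of the formula is the value of the literal. [folklore] -/
theorem yesAssign_litVar {V : List ℕ} (σ : ℕ → Bool) {l : Literal ℕ} (h : l.1 ∈ V) :
    yesAssign V σ (litVar V l) = l.eval σ := by
  unfold litVar Literal.eval
  obtain ⟨x, b⟩ := l
  cases b
  · simp only [Bool.toNat_false, add_zero]
    rw [yesAssign_even, getD_firstIdx 0 h]
  · simp only [Bool.toNat_true]
    rw [yesAssign_odd, getD_firstIdx 0 h]

/-- **A satisfiable `3`-CNF gives a yes-instance** of degree `≤ 3`: the induced assignment weighs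
exactly `N` and satisfies every clause and totality formula. [cite: AlekhnovichEtAl2001, §2; Hirahara2022PartialMCSP, proof of Thm. 5.2 (completeness)] -/
theorem toCMMSA_mem_yesSet {φ : CNF ℕ} (hw : φ.IsWidthLE 3) (hsat : φ.Satisfiable) :
    toCMMSA φ ∈ CMMSA.yesSet fun _ => 3 := by
  obtain ⟨σ, hσ⟩ := hsat
  set V := varList φ with hV
  refine ⟨wellFormed_toCMMSA φ, degree_toCMMSA_le hw, yesAssign V σ, ?_, fun ψ hψ => ?_⟩
  · -- weight exactly `N`
    rw [weightOf_toCMMSA]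
    show _ ≤ V.length
    rw [← hV]
    calc ∑ u ∈ Finset.range V.length,
          occW V u * ((if yesAssign V σ (2 * u) then 1 else 0) + (if yesAssign V σ (2 * u + 1) then 1 else 0))
        = ∑ u ∈ Finset.range V.length, occW V u := Finset.sum_congr rfl fun u _ => by
          rw [yesAssign_even, yesAssign_odd]
          cases σ (V.getD u 0) <;> simp
      _ = V.length := sum_occW V
      _ ≤ V.length := le_rfl
  · rcases (mem_formulas_iff φ ψ).1 hψ with ⟨C, hC, rfl⟩ | ⟨u, -, rfl⟩
    · -- a true literal of the clause
      have hCσ : C.any (Literal.eval σ) = true := by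
        unfold CNF.eval at hσ
        exact List.all_eq_true.1 hσ C hC
      obtain ⟨l, hl, hlσ⟩ := List.any_eq_true.1 hCσ
      rw [MonotoneDNF.eval_eq_true_iff]
      refine ⟨[litVar V l], List.mem_map.2 ⟨l, hl, rfl⟩, fun i hi => ?_⟩
      rw [List.mem_singleton] at hi
      subst hi
      rw [yesAssign_litVar σ (by rw [hV]; exact mem_varList hC hl)]
      exact hlσ
    · rw [MonotoneDNF.eval_eq_true_iff]
      cases hx : σ (V.getD u 0)
      · refine ⟨[2 * u], by simp [totFormula], fun i hi => ?_⟩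
        rw [List.mem_singleton] at hi; subst hi
        rw [yesAssign_even, hx]; rfl
      · refine ⟨[2 * u + 1], by simp [totFormula], fun i hi => ?_⟩
        rw [List.mem_singleton] at hi; subst hi
        rw [yesAssign_odd, hx]; rfl

/-! ### Soundness -/

/-- A list-sum/finset-sum interchange. [folklore] -/
theorem finset_sum_list_sum {ι α : Type} (s : Finset ι) (f : ι → α → ℕ) : ∀ l : List α,
    ∑ i ∈ s, (l.map (f i)).sum = (l.map fun a => ∑ i ∈ s, f i a).sum
  | [] => by simp
  | a :: l => by
    simp only [List.map_cons, List.sum_cons, Finset.sum_add_distrib, finset_sum_list_sum s f l]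

/-- Pointwise comparison of mapped sums. [folklore] -/
theorem sum_map_le_sum_map {α : Type} {f g : α → ℕ} : ∀ {l : List α}, (∀ a ∈ l, f a ≤ g a) →
    (l.map f).sum ≤ (l.map g).sum
  | [], _ => le_rfl
  | a :: l, h => by
    simp only [List.map_cons, List.sum_cons]
    exact Nat.add_le_add (h a List.mem_cons_self) (sum_map_le_sum_map fun b hb => h b (List.mem_cons_of_mem _ hb))

/-- `countP` as a sum of indicators. [folklore] -/
theorem countP_eq_sum_map {α : Type} (p : α → Bool) : ∀ l : List α,
    l.countP p = (l.map fun a => if p a then 1 else 0).sum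
  | [] => rfl
  | a :: l => by
    rw [List.countP_cons, List.map_cons, List.sum_cons, countP_eq_sum_map p l]
    cases p a <;> simp [Nat.add_comm]

/-- The occurrence weight of `u`, clause by clause. [folklore] -/
theorem occW_eq_sum (φ : CNF ℕ) (u : ℕ) :
    occW (varList φ) u = (φ.map fun C => C.countP fun l => decide (firstIdx l.1 (varList φ) = u)).sum := by
  unfold occW
  conv_lhs => rw [show varList φ = φ.flatten.map Prod.fst from rfl]
  rw [List.countP_map, List.countP_flatten]
  rfl

/-- **A `3`-CNF of value `≤ 7/8 + ε` (`ε < 1/8`) gives a no-instance at the gap `baseGap ε`**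
(soundness `1`, degree `3`). [cite: AlekhnovichEtAl2001, §2 (proof of Thm. 3, the factor of the hitting-set reduction); Hirahara2022PartialMCSP, proof of Thm. 5.2 (soundness, pp. 17–18)] -/
theorem toCMMSA_mem_noSet {φ : CNF ℕ} {ε : ℚ} (hε : ε < 1 / 8) (hw : φ.IsWidthLE 3)
    (hval : φ.maxSatFraction ≤ 7 / 8 + ε) :
    toCMMSA φ ∈ CMMSA.noSet (fun _ => baseGap ε) (fun _ => 1) fun _ => 3 := by
  refine ⟨wellFormed_toCMMSA φ, degree_toCMMSA_le hw, fun a ha => ?_⟩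
  rw [real_satCount_lt_one_iff]
  set V := varList φ with hV
  set N := V.length with hN
  set m := φ.numClauses with hm
  -- `m > 0`: the empty CNF has value `1`
  have hm0 : 0 < m := by
    rw [hm]
    by_contra h0
    push Not at h0
    have hnil : φ = [] := List.eq_nil_of_length_eq_zero (Nat.le_zero.1 h0)
    subst hnil
    rw [CNF.maxSatFraction_nil] at hval
    linarith
  have hε8 : (0 : ℝ) < 1 / 8 - ε := by
    have : (ε : ℝ) < 1 / 8 := by
      have h := (Rat.cast_lt (K := ℝ)).2 hε
      simpa using h
    linarith
  -- suppose every formula holds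
  by_contra hne
  push Not at hne
  have hall : ∀ ψ ∈ (toCMMSA φ).formulas, ψ.eval a = true := fun ψ hψ => by
    cases h : ψ.eval a
    · exact absurd h (hne ψ hψ)
    · rfl
  -- totality
  have htot : ∀ u < N, a (2 * u) = true ∨ a (2 * u + 1) = true := by
    intro u hu
    have h := hall (totFormula u) ((mem_formulas_iff φ _).2 (Or.inr ⟨u, hu, rfl⟩))
    rw [MonotoneDNF.eval_eq_true_iff] at h
    obtain ⟨t, ht, hta⟩ := h
    simp only [totFormula, List.mem_cons, List.not_mem_nil, or_false] at ht
    rcases ht with rfl | rfl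
    · exact Or.inl (hta _ (List.mem_singleton_self _))
    · exact Or.inr (hta _ (List.mem_singleton_self _))
  -- the doubly-set variables
  set D : Finset ℕ := (Finset.range N).filter fun u => a (2 * u) = true ∧ a (2 * u + 1) = true with hD
  -- the weight identity `w(a) = N + occ(D)`
  have hWeq : (toCMMSA φ).weightOf a = N + ∑ u ∈ D, occW V u := by
    rw [weightOf_toCMMSA, ← hV, hD, Finset.sum_filter]
    calc _ = ∑ u ∈ Finset.range N, (occW V u + (if a (2 * u) = true ∧ a (2 * u + 1) = true then occW V u else 0)) :=
          Finset.sum_congr rfl fun u hu => by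
            have ht := htot u (Finset.mem_range.1 hu)
            by_cases h0 : a (2 * u) = true
            · by_cases h1 : a (2 * u + 1) = true
              · simp [h0, h1, mul_two]
              · simp [h0, h1]
            · by_cases h1 : a (2 * u + 1) = true
              · simp [h0, h1]
              · exact absurd ht (by simp [h0, h1])
      _ = N + ∑ u ∈ Finset.range N, (if a (2 * u) = true ∧ a (2 * u + 1) = true then occW V u else 0) := by
          rw [Finset.sum_add_distrib, sum_occW]
  -- hence `occ(D) ≤ (g - 1) N ≤ 3 (g - 1) m`
  have hNm : N ≤ 3 * m := by rw [hN, hV, length_varList]; exact size_le_of_isWidthLE hw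
  have hoccD : (∑ u ∈ D, (occW V u : ℝ)) ≤ (baseGap ε - 1) * (3 * m) := by
    have ha' : ((toCMMSA φ).weightOf a : ℝ) ≤ baseGap ε * N := ha
    rw [hWeq] at ha'
    push_cast at ha'
    have hg1 : 0 ≤ baseGap ε - 1 := by linarith [one_lt_baseGap hε]
    have hNm' : (N : ℝ) ≤ 3 * m := by exact_mod_cast hNm
    nlinarith [mul_le_mul_of_nonneg_left hNm' hg1]
  -- the assignment read off the odd variables
  set σ : ℕ → Bool := fun x => a (2 * firstIdx x V + 1) with hσ
  -- clauses not touching `D` are satisfied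
  set touch : Clause ℕ → Bool := fun C => C.any fun l => decide (firstIdx l.1 V ∈ D) with htouch
  have hsatC : ∀ C ∈ φ, touch C = false → C.eval σ = true := by
    intro C hC hnt
    have h := hall (clauseFormula V C) ((mem_formulas_iff φ _).2 (Or.inl ⟨C, hC, hV ▸ rfl⟩))
    rw [MonotoneDNF.eval_eq_true_iff] at h
    obtain ⟨t, ht, hta⟩ := h
    obtain ⟨l, hl, rfl⟩ := List.mem_map.1 ht
    have hal : a (litVar V l) = true := hta _ (List.mem_singleton_self _)
    have hlV : l.1 ∈ V := hV ▸ mem_varList hC hl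
    set u := firstIdx l.1 V with hu
    have huN : u < N := firstIdx_lt_length hlV
    have huD : u ∉ D := by
      intro huD
      have : touch C = true := List.any_eq_true.2 ⟨l, hl, by simpa [← hu] using huD⟩
      rw [this] at hnt
      exact Bool.noConfusion hnt
    have hnotBoth : ¬ (a (2 * u) = true ∧ a (2 * u + 1) = true) := fun hb =>
      huD (Finset.mem_filter.2 ⟨Finset.mem_range.2 huN, hb⟩)
    unfold Clause.eval
    refine List.any_eq_true.2 ⟨l, hl, ?_⟩
    unfold Literal.eval
    show (a (2 * firstIdx l.1 V + 1) == l.2) = true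
    rw [← hu]
    obtain ⟨x, b⟩ := l
    cases b
    · -- `x_{u,0}` is set, so `x_{u,1}` is not
      have h0 : a (2 * u) = true := by simpa [litVar, ← hu] using hal
      have h1 : a (2 * u + 1) = false := by
        cases h : a (2 * u + 1)
        · rfl
        · exact absurd ⟨h0, h⟩ hnotBoth
      rw [h1]; rfl
    · have h1 : a (2 * u + 1) = true := by simpa [litVar, ← hu] using hal
      rw [h1]; rfl
  -- counting: `m ≤ #sat(σ) + #touching`
  have hcount1 : m ≤ φ.countP (fun C => C.eval σ) + φ.countP touch := by
    rw [hm, show φ.numClauses = φ.length from rfl, List.length_eq_countP_add_countP (p := touch) (l := φ), Nat.add_comm]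
    refine Nat.add_le_add_right (List.countP_mono_left fun C hC hnt => hsatC C hC ?_) _
    simpa using hnt
  -- `#touching ≤ occ(D)`
  have hcount2 : φ.countP touch ≤ ∑ u ∈ D, occW V u := by
    have hocc : ∀ u, occW V u = (φ.map fun C => C.countP fun l => decide (firstIdx l.1 V = u)).sum :=
      fun u => by rw [hV]; exact occW_eq_sum φ u
    simp only [hocc]
    rw [finset_sum_list_sum, countP_eq_sum_map]
    refine sum_map_le_sum_map fun C _ => ?_
    split_ifs with hC
    · obtain ⟨l, hl, hlD⟩ := List.any_eq_true.1 hC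
      have hlD' : firstIdx l.1 V ∈ D := by simpa using hlD
      refine le_trans ?_ (Finset.single_le_sum (fun u _ => Nat.zero_le _) hlD')
      exact List.countP_pos_iff.2 ⟨l, hl, by simp⟩
    · exact Nat.zero_le _
  -- the value bound: `#sat(σ) ≤ (7/8 + ε) m`
  have hcount3 : (φ.countP (fun C => C.eval σ) : ℝ) ≤ (7 / 8 + ε) * m := by
    have h := (CNF.satisfiedFraction_le_maxSatFraction φ σ).trans hval
    unfold CNF.satisfiedFraction at h
    rw [if_neg hm0.ne'] at h
    have hmq : (0 : ℚ) < φ.numClauses := by exact_mod_cast hm0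
    rw [div_le_iff₀ hmq] at h
    have h' : ((φ.countP fun C => C.eval σ : ℕ) : ℝ) ≤ ((7 / 8 + ε) * φ.numClauses : ℚ) := by
      exact_mod_cast h
    push_cast at h'
    exact h'
  -- contradiction
  have h1 : (m : ℝ) ≤ φ.countP (fun C => C.eval σ) + φ.countP touch := by exact_mod_cast hcount1
  have h2 : (φ.countP touch : ℝ) ≤ ∑ u ∈ D, (occW V u : ℝ) := by exact_mod_cast hcount2
  have hmR : (0 : ℝ) < m := by exact_mod_cast hm0
  unfold baseGap at hoccD
  nlinarith

end CNFToCMMSA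

end Literature.Computability.Complexity
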